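import Summits.AtomisticToContinuum.Crystallization.Theorems.FrustratedLawDichotomyCellT2flatData

/-!
# FrustratedLawDichotomy · crux `AperiodicFrustratedLawGap` (stmt-AtomisticToContinuum-27623) — T′♭₄₅ witness cell: class checks 12–15
# (decomp-a2c, prover hand 1, generation 15; kernel evaluations of `Cell.checkClassBad`, split for build time)

Each theorem is ONE `decide +kernel` of `cellT2.checkClassBad m (cellT2Cert m)`: nn witness, far witness at `≥ 9/8·d`, the 11664-point pinning scan and
the class site-sum bound.  [folklore]
-/

namespace Summit.AtomisticToContinuum.Crystallization.Theorems.FrustratedLawDichotomyCellT2flatCeiling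

open Summit.AtomisticToContinuum.Crystallization.Theorems.FrustratedLawDichotomyCellChecker


set_option maxHeartbeats 0 in
/-- Class `12` of `cellT2` passes `checkClassBad` (kernel evaluation). [folklore] -/
theorem cellT2_checkClass12 : cellT2.checkClassBad ⟨12, by decide⟩ (cellT2Cert 12) = true := by decide +kernel

set_option maxHeartbeats 0 in
/-- Class `13` of `cellT2` passes `checkClassBad` (kernel evaluation). [folklore] -/
theorem cellT2_checkClass13 : cellT2.checkClassBad ⟨13, by decide⟩ (cellT2Cert 13) = true := by decide +kernel

set_option maxHeartbeats 0 in
/-- Class `14` of `cellT2` passes `checkClassBad` (kernel evaluation). [folklore] -/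
theorem cellT2_checkClass14 : cellT2.checkClassBad ⟨14, by decide⟩ (cellT2Cert 14) = true := by decide +kernel

set_option maxHeartbeats 0 in
/-- Class `15` of `cellT2` passes `checkClassBad` (kernel evaluation). [folklore] -/
theorem cellT2_checkClass15 : cellT2.checkClassBad ⟨15, by decide⟩ (cellT2Cert 15) = true := by decide +kernel

end Summit.AtomisticToContinuum.Crystallization.Theorems.FrustratedLawDichotomyCellT2flatCeiling
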